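import Mathlib
import HarnessLib
import Summits.HubbardSuperconductivity.HubbardSuperconductivity.Theorems.KLProgrammeKLRegimeEnginePairLadderResolvedDuhamelSums

/-!
# Route `KLProgramme` — ENGINE child gen 8 (stmt-HubbardSuperconductivity-20437 `KLRegimeEngineV17F2`), skeleton v2 class #5 rev 3:
# the RESOLVED two-sided dressed Duhamel bound — `kltc_resolved_dressing_duhamel`
# (cell gate-hubbard-kl, seat hubbard-kl-k3c1-p1 g15, technique «composed-map remainder propagation»)

WHY.  The class-#5 STEP door of record `kltc_relative_flow_duhamel` (p583555, over `kltc_tangent_duhamel` p545005) solves the linearly dressed tangent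
flow `Ė = −(A₁·diag ḃ₁·E + E·diag ḃ₂·A₂) + X_rel` by CONJUGATION with the time-`0` resolvents, which lets the two members' Riccati defects `S₁, S₂` in
through SUP norms only: the Bethe–Salpeter defects `(8/3)ξᵢ` in the uniform term `(4/3)·B·β·(η₁+η₂)` and the a priori `B = δe^{2mβ} + 2 sup|X_rel|`.
Those sup entries are exactly where the flat `M4²` member particle–hole rows meet the ROOM of `transferBarRelIdx` without a slot — the located
«(X).3-PH-CUBIC-SLOT» (pen (R171), KLTC-INDEX v11 §E).  This file proves the door that removes them: a GENUINE resolved Gronwall for the two-sided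
dressed flow, by the adjoint-supersolution method — for fixed `(x,y)` the weights `φ_s(a) = δ_{xa} + (3m/2)·v₁(s,a)`, `ψ_s(c) = δ_{cy} + v₂(s,c)·(3m/2)`
built on REMAINING-VARIATION majorants `vᵢ(s,·)` of the rates (`‖ḃᵢ(s,a)‖ ≤ −v̇ᵢ(s,a)`, `vᵢ(1,·) ≥ 0`, `m·Σ_a vᵢ(0,a) ≤ 1/3`) make
`q(s) = Σ_{a,c} φ_s(a)‖E(s)(a,c)‖ψ_s(c)` a sub-solution: `D⁺q ≤ Σ φ_s‖X(s)‖ψ_s` (the dressing is absorbed because `1 + (3m/2)·(1/3)·… ≤ 3/2`), whence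
(Mathlib's fencing lemma `image_le_of_liminf_slope_right_le_deriv_boundary`)

  `‖E(1)(x,y)‖ ≤ G(x,y) + Σ_c G(x,c)·v₂(0,c)·(3m/2) + Σ_a (3m/2)·v₁(0,a)·G(a,y) + Σ_aΣ_c (3m/2)v₁(0,a)·G(a,c)·v₂(0,c)(3m/2)`,
  `G(x,y) ≥ ‖E(0)(x,y)‖ + ∫₀¹‖X(t)(x,y)‖dt`

— the SAME four-term FT shape as `kltc_tangent_duhamel`'s output, with NO Bethe–Salpeter defects, NO a priori `B`, NO sup of the source, NO rate `β`:
the source enters ONLY through its resolved slice integral.  (In the model `vᵢ(s,c) = bᵢ(1,c) − bᵢ(s,c)` for the monotone rung weights, so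
`vᵢ(0,·) ≤ klRungProfile`.)  Consequence for class #5 (next file `…RelativeFlowResolved`): in the relative step the member defects enter ONLY convolved
against the relative weight, `Σ_c ‖S₁(x,c)‖·|a(c)|·m` — an angular-mass slot — instead of `sup|S₁|·Σ|a|·m` and `(4/3)Bβ(8/3)ξ₁`.
Real analysis + finite sums only; nothing about the model is asserted; nothing asserts (X).3, (c), K3 or superconductivity.  0 kit · 0 lit.
-/

noncomputable section

namespace Summit.HubbardSuperconductivity.HubbardSuperconductivity.Theorems.KLRegimeSplit

set_option linter.dupNamespace false -- summit = problem name (single-conjunct summit), D-0017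

open Finset Matrix Set Filter Topology
open Summit.HubbardSuperconductivity.HubbardSuperconductivity.Theorems.KLProgrammeCooperResummation

/-! ## §2 The resolved two-sided dressed Duhamel bound -/

section ResolvedDuhamel

variable {ι : Type*} [Fintype ι] [DecidableEq ι]

set_option maxHeartbeats 400000 in -- long real-analysis proof (fencing lemma + slope limits + sum bookkeeping); pre-empts the 180k cliff probe
/-- **Resolved two-sided dressed Duhamel.**  On `[0,1]`: `E` entrywise-C¹ with `Ė = −(Γ₁·diag ḃ₁·E + E·diag ḃ₂·Γ₂) + X` (`X` entrywise continuous),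
dressers `|Γᵢ(t)| ≤ m`, and REMAINING-VARIATION majorants `vᵢ` of the rates: `vᵢ(·,a)` differentiable on `[0,1]` with `‖ḃᵢ(t,a)‖ ≤ −v̇ᵢ(t,a)`,
`vᵢ(1,a) ≥ 0`, and `m·Σ_a vᵢ(0,a) ≤ 1/3`.  Then for every `G(x,y) ≥ ‖E(0)(x,y)‖ + ∫₀¹‖X(t)(x,y)‖dt`:
`‖E(1)(x,y)‖ ≤ G(x,y) + Σ_c G(x,c)·v₂(0,c)·(3m/2) + Σ_a (3m/2)·v₁(0,a)·G(a,y) + Σ_aΣ_c (3m/2)·v₁(0,a)·G(a,c)·v₂(0,c)·(3m/2)` —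
no Bethe–Salpeter defects, no a priori sup, no sup of the source. -/
theorem kltc_resolved_dressing_duhamel (E E' X Γ₁ Γ₂ : ℝ → Matrix ι ι ℂ) (b₁' b₂' : ℝ → ι → ℂ)
    (v₁ v₂ v₁' v₂' : ℝ → ι → ℝ) (G : ι → ι → ℝ) {m : ℝ} (hm : 0 ≤ m)
    (hE : ∀ t ∈ Icc (0 : ℝ) 1, ∀ x y, HasDerivAt (fun s => E s x y) (E' t x y) t)
    (hXc : ∀ x y, ContinuousOn (fun t => X t x y) (Icc 0 1))
    (hflow : ∀ t ∈ Icc (0 : ℝ) 1, E' t = -(Γ₁ t * diagonal (b₁' t) * E t + E t * diagonal (b₂' t) * Γ₂ t) + X t)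
    (hΓ₁ : ∀ t ∈ Icc (0 : ℝ) 1, ∀ x y, ‖Γ₁ t x y‖ ≤ m) (hΓ₂ : ∀ t ∈ Icc (0 : ℝ) 1, ∀ x y, ‖Γ₂ t x y‖ ≤ m)
    (hv₁ : ∀ t ∈ Icc (0 : ℝ) 1, ∀ a, HasDerivAt (fun s => v₁ s a) (v₁' t a) t)
    (hv₂ : ∀ t ∈ Icc (0 : ℝ) 1, ∀ a, HasDerivAt (fun s => v₂ s a) (v₂' t a) t)
    (hr₁ : ∀ t ∈ Icc (0 : ℝ) 1, ∀ a, ‖b₁' t a‖ ≤ -v₁' t a) (hr₂ : ∀ t ∈ Icc (0 : ℝ) 1, ∀ a, ‖b₂' t a‖ ≤ -v₂' t a)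
    (hv₁1 : ∀ a, 0 ≤ v₁ 1 a) (hv₂1 : ∀ a, 0 ≤ v₂ 1 a)
    (hZ₁ : m * ∑ a, v₁ 0 a ≤ 1 / 3) (hZ₂ : m * ∑ a, v₂ 0 a ≤ 1 / 3)
    (hG : ∀ x y, ‖E 0 x y‖ + (∫ t in (0 : ℝ)..1, ‖X t x y‖) ≤ G x y) (x y : ι) :
    ‖E 1 x y‖ ≤ G x y + ∑ c, G x c * v₂ 0 c * (3 / 2 * m) + ∑ a, 3 / 2 * m * v₁ 0 a * G a y +
        ∑ a, ∑ c, 3 / 2 * m * v₁ 0 a * G a c * v₂ 0 c * (3 / 2 * m) := by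
  have h01 : (0 : ℝ) ∈ Icc (0 : ℝ) 1 := ⟨le_rfl, zero_le_one⟩
  have h11 : (1 : ℝ) ∈ Icc (0 : ℝ) 1 := ⟨zero_le_one, le_rfl⟩
  -- (1) the remaining variations are antitone on `[0,1]`, hence nonnegative and below their initial value
  have hanti : ∀ (v v' : ℝ → ι → ℝ) (b' : ℝ → ι → ℂ), (∀ t ∈ Icc (0 : ℝ) 1, ∀ a, HasDerivAt (fun s => v s a) (v' t a) t) →
      (∀ t ∈ Icc (0 : ℝ) 1, ∀ a, ‖b' t a‖ ≤ -v' t a) → ∀ a, AntitoneOn (fun s => v s a) (Icc 0 1) := by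
    intro v v' b' hv hr a
    refine antitoneOn_of_hasDerivWithinAt_nonpos (f' := fun t => v' t a) (convex_Icc 0 1)
      (fun t ht => (hv t ht a).continuousAt.continuousWithinAt) (fun t ht => ?_) (fun t ht => ?_)
    · rw [interior_Icc] at ht
      exact (hv t (Ioo_subset_Icc_self ht) a).hasDerivWithinAt
    · rw [interior_Icc] at ht
      have := hr t (Ioo_subset_Icc_self ht) a
      linarith [norm_nonneg (b' t a)]
  have hanti₁ := hanti v₁ v₁' b₁' hv₁ hr₁
  have hanti₂ := hanti v₂ v₂' b₂' hv₂ hr₂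
  have hv₁nn : ∀ t ∈ Icc (0 : ℝ) 1, ∀ a, 0 ≤ v₁ t a := fun t ht a => (hv₁1 a).trans (hanti₁ a ht h11 ht.2)
  have hv₂nn : ∀ t ∈ Icc (0 : ℝ) 1, ∀ a, 0 ≤ v₂ t a := fun t ht a => (hv₂1 a).trans (hanti₂ a ht h11 ht.2)
  have hv₁le : ∀ t ∈ Icc (0 : ℝ) 1, ∀ a, v₁ t a ≤ v₁ 0 a := fun t ht a => hanti₁ a h01 ht ht.1
  have hv₂le : ∀ t ∈ Icc (0 : ℝ) 1, ∀ a, v₂ t a ≤ v₂ 0 a := fun t ht a => hanti₂ a h01 ht ht.1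
  -- (2) the weights
  set φ : ℝ → ι → ℝ := fun s a => (if a = x then (1 : ℝ) else 0) + 3 / 2 * m * v₁ s a with hφ_def
  set ψ : ℝ → ι → ℝ := fun s c => (if c = y then (1 : ℝ) else 0) + v₂ s c * (3 / 2 * m) with hψ_def
  have hφnn : ∀ t ∈ Icc (0 : ℝ) 1, ∀ a, 0 ≤ φ t a := fun t ht a => by
    simp only [hφ_def]; have := hv₁nn t ht a; positivity
  have hψnn : ∀ t ∈ Icc (0 : ℝ) 1, ∀ c, 0 ≤ ψ t c := fun t ht c => by
    simp only [hψ_def]; have := hv₂nn t ht c; positivity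
  have hφle : ∀ t ∈ Icc (0 : ℝ) 1, ∀ a, φ t a ≤ φ 0 a := fun t ht a => by
    simp only [hφ_def]
    exact add_le_add le_rfl (mul_le_mul_of_nonneg_left (hv₁le t ht a) (by positivity))
  have hψle : ∀ t ∈ Icc (0 : ℝ) 1, ∀ c, ψ t c ≤ ψ 0 c := fun t ht c => by
    simp only [hψ_def]
    exact add_le_add le_rfl (mul_le_mul_of_nonneg_right (hv₂le t ht c) (by positivity))
  have hφd : ∀ t ∈ Icc (0 : ℝ) 1, ∀ a, HasDerivAt (fun s => φ s a) (3 / 2 * m * v₁' t a) t := fun t ht a => by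
    simp only [hφ_def]
    exact ((hv₁ t ht a).const_mul (3 / 2 * m)).const_add _
  have hψd : ∀ t ∈ Icc (0 : ℝ) 1, ∀ c, HasDerivAt (fun s => ψ s c) (v₂' t c * (3 / 2 * m)) t := fun t ht c => by
    simp only [hψ_def]
    exact ((hv₂ t ht c).mul_const (3 / 2 * m)).const_add _
  have hSφ : ∀ t ∈ Icc (0 : ℝ) 1, ∑ a, φ t a ≤ 3 / 2 := fun t ht => by
    simp only [hφ_def]
    rw [sum_add_distrib, sum_ite_eq' univ x, ← mul_sum]
    simp only [Finset.mem_univ, if_true]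
    have h1 : ∑ a, v₁ t a ≤ ∑ a, v₁ 0 a := sum_le_sum fun a _ => hv₁le t ht a
    have h2 : 0 ≤ ∑ a, v₁ t a := sum_nonneg fun a _ => hv₁nn t ht a
    nlinarith
  have hSψ : ∀ t ∈ Icc (0 : ℝ) 1, ∑ c, ψ t c ≤ 3 / 2 := fun t ht => by
    simp only [hψ_def]
    rw [sum_add_distrib, sum_ite_eq' univ y, ← sum_mul]
    simp only [Finset.mem_univ, if_true]
    have h1 : ∑ c, v₂ t c ≤ ∑ c, v₂ 0 c := sum_le_sum fun c _ => hv₂le t ht c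
    have h2 : 0 ≤ ∑ c, v₂ t c := sum_nonneg fun c _ => hv₂nn t ht c
    nlinarith
  -- (3) the functional `q`, the source density `g`, continuity
  set q : ℝ → ℝ := fun s => ∑ a, ∑ c, φ s a * ‖E s a c‖ * ψ s c with hq_def
  set g : ℝ → ℝ := fun s => ∑ a, ∑ c, φ s a * ‖X s a c‖ * ψ s c with hg_def
  have hφc : ∀ a, ContinuousOn (fun s => φ s a) (Icc 0 1) := fun a t ht => (hφd t ht a).continuousAt.continuousWithinAt
  have hψc : ∀ c, ContinuousOn (fun s => ψ s c) (Icc 0 1) := fun c t ht => (hψd t ht c).continuousAt.continuousWithinAt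
  have hEc : ∀ a c, ContinuousOn (fun s => ‖E s a c‖) (Icc 0 1) := fun a c t ht =>
    ((hE t ht a c).continuousAt.continuousWithinAt).norm
  have hqc : ContinuousOn q (Icc 0 1) := by
    simp only [hq_def]
    exact continuousOn_finsetSum _ fun a _ => continuousOn_finsetSum _ fun c _ => ((hφc a).mul (hEc a c)).mul (hψc c)
  have hgc : ContinuousOn g (Icc 0 1) := by
    simp only [hg_def]
    exact continuousOn_finsetSum _ fun a _ => continuousOn_finsetSum _ fun c _ => ((hφc a).mul ((hXc a c).norm)).mul (hψc c)
  -- (4) the comparison function `B s = q 0 + ∫₀ˢ g̃`, `g̃` = `g` clamped to `[0,1]` (continuous on `ℝ`)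
  set cl : ℝ → ℝ := fun s => max 0 (min s 1) with hcl_def
  have hcl_cont : Continuous cl := continuous_const.max (continuous_id.min continuous_const)
  have hcl_mem : ∀ s, cl s ∈ Icc (0 : ℝ) 1 := fun s => ⟨le_max_left _ _, max_le zero_le_one (min_le_right _ _)⟩
  have hcl_eq : ∀ s ∈ Icc (0 : ℝ) 1, cl s = s := fun s hs => by
    simp only [hcl_def]; rw [min_eq_left hs.2, max_eq_right hs.1]
  set gt : ℝ → ℝ := g ∘ cl with hgt_def
  have hgt_cont : Continuous gt := hgc.comp_continuous hcl_cont hcl_mem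
  have hgt_eq : ∀ s ∈ Icc (0 : ℝ) 1, gt s = g s := fun s hs => by simp only [hgt_def, Function.comp, hcl_eq s hs]
  set B : ℝ → ℝ := fun s => q 0 + ∫ τ in (0 : ℝ)..s, gt τ with hB_def
  have hBd : ∀ s, HasDerivAt B (gt s) s := fun s => by
    show HasDerivAt (fun u => q 0 + ∫ τ in (0 : ℝ)..u, gt τ) (gt s) s
    exact (hgt_cont.integral_hasStrictDerivAt 0 s).hasDerivAt.const_add _
  -- (5) the fencing lemma: `q 1 ≤ B 1`
  have hqB : q 1 ≤ B 1 := by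
    refine image_le_of_liminf_slope_right_le_deriv_boundary (B := B) (B' := gt) hqc ?_
      (fun s _ => (hBd s).continuousAt.continuousWithinAt) (fun s _ => (hBd s).hasDerivWithinAt) ?_ h11
    · simp only [hB_def, intervalIntegral.integral_same, add_zero, le_refl]
    · intro s hs r hr
      have hs' : s ∈ Icc (0 : ℝ) 1 := Ico_subset_Icc_self hs
      rw [hgt_eq s hs'] at hr
      -- the upper slope function `U` and its limit `ℓ`
      set U : ℝ → ℝ := fun z => ∑ a, ∑ c, (slope (fun τ => φ τ a * ψ τ c) s z * ‖E s a c‖ +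
        φ z a * ψ z c * ‖slope (fun τ => E τ a c) s z‖) with hU_def
      set ℓ : ℝ := ∑ a, ∑ c, ((3 / 2 * m * v₁' s a * ψ s c + φ s a * (v₂' s c * (3 / 2 * m))) * ‖E s a c‖ +
        φ s a * ψ s c * ‖E' s a c‖) with hℓ_def
      have hnot : s ∉ Ioi s := fun h => lt_irrefl s h
      have hU : Tendsto U (𝓝[>] s) (𝓝 ℓ) := by
        simp only [hU_def, hℓ_def]
        refine tendsto_finsetSum _ fun a _ => tendsto_finsetSum _ fun c _ => Tendsto.add ?_ ?_
        · refine Tendsto.mul ?_ tendsto_const_nhds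
          have hd : HasDerivAt (fun τ => φ τ a * ψ τ c) (3 / 2 * m * v₁' s a * ψ s c + φ s a * (v₂' s c * (3 / 2 * m))) s :=
            (hφd s hs' a).mul (hψd s hs' c)
          exact (hasDerivWithinAt_iff_tendsto_slope' hnot).mp hd.hasDerivWithinAt
        · refine Tendsto.mul (Tendsto.mul ?_ ?_) ?_
          · exact ((hφd s hs' a).continuousAt.tendsto).mono_left nhdsWithin_le_nhds
          · exact ((hψd s hs' c).continuousAt.tendsto).mono_left nhdsWithin_le_nhds
          · exact ((hasDerivWithinAt_iff_tendsto_slope' hnot).mp (hE s hs' a c).hasDerivWithinAt).norm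
      -- the limit is below the source density (the supersolution inequality)
      have hℓ : ℓ ≤ g s := by
        simp only [hℓ_def, hg_def]
        have key := kltc_rd_supersolution_le (φ s) (ψ s) (fun a => 3 / 2 * m * v₁' s a) (fun c => v₂' s c * (3 / 2 * m))
          (fun a => ‖b₁' s a‖) (fun c => ‖b₂' s c‖) (fun a c => ‖E s a c‖) (fun a c => ‖E' s a c‖) (fun a c => ‖X s a c‖) hm
          (hφnn s hs') (hψnn s hs') (fun a => norm_nonneg _) (fun c => norm_nonneg _) (fun a c => norm_nonneg _)
          (fun a => ?_) (fun c => ?_) (hSφ s hs') (hSψ s hs') (fun a c => ?_)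
        · exact key
        · have := hr₁ s hs' a; nlinarith
        · have := hr₂ s hs' c; nlinarith
        · rw [hflow s hs']
          exact kltc_rd_entry_rate_le (Γ₁ s) (Γ₂ s) (E s) (X s) (b₁' s) (b₂' s) (hΓ₁ s hs') (hΓ₂ s hs') a c
      -- `slope q s z ≤ U z` just to the right of `s`
      have hle : ∀ᶠ z in 𝓝[>] s, slope q s z ≤ U z := by
        filter_upwards [Ioo_mem_nhdsGT hs.2] with z hz
        have hz' : z ∈ Icc (0 : ℝ) 1 := ⟨hs.1.trans hz.1.le, hz.2.le⟩
        have hzs : 0 < z - s := sub_pos.mpr hz.1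
        rw [slope_def_field, div_le_iff₀ hzs]
        have hterm : ∀ a c, φ z a * ‖E z a c‖ * ψ z c - φ s a * ‖E s a c‖ * ψ s c ≤
            (slope (fun τ => φ τ a * ψ τ c) s z * ‖E s a c‖ + φ z a * ψ z c * ‖slope (fun τ => E τ a c) s z‖) * (z - s) := by
          intro a c
          have h1 : slope (fun τ => φ τ a * ψ τ c) s z * (z - s) = φ z a * ψ z c - φ s a * ψ s c := by
            rw [slope_def_field, div_mul_cancel₀ _ hzs.ne']
          have h2 : ‖slope (fun τ => E τ a c) s z‖ * (z - s) = ‖E z a c - E s a c‖ := by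
            rw [slope_def_module, norm_smul, norm_inv, Real.norm_eq_abs, abs_of_pos hzs]
            field_simp
          have h3 : ‖E z a c‖ ≤ ‖E s a c‖ + ‖E z a c - E s a c‖ := norm_le_insert' _ _
          have h4 : 0 ≤ φ z a * ψ z c := mul_nonneg (hφnn z hz' a) (hψnn z hz' c)
          calc φ z a * ‖E z a c‖ * ψ z c - φ s a * ‖E s a c‖ * ψ s c
              ≤ φ z a * (‖E s a c‖ + ‖E z a c - E s a c‖) * ψ z c - φ s a * ‖E s a c‖ * ψ s c := by
                have := mul_le_mul_of_nonneg_left h3 h4; nlinarith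
            _ = (φ z a * ψ z c - φ s a * ψ s c) * ‖E s a c‖ + φ z a * ψ z c * ‖E z a c - E s a c‖ := by ring
            _ = _ := by rw [← h1, ← h2]; ring
        have hsum : q z - q s = ∑ a, ∑ c, (φ z a * ‖E z a c‖ * ψ z c - φ s a * ‖E s a c‖ * ψ s c) := by
          simp only [hq_def, ← sum_sub_distrib]
        rw [hsum]
        simp only [hU_def]
        rw [sum_mul]
        refine sum_le_sum fun a _ => ?_
        rw [sum_mul]
        exact sum_le_sum fun c _ => hterm a c
      have hev : ∀ᶠ z in 𝓝[>] s, U z < r := (tendsto_order.1 hU).2 r (hℓ.trans_lt hr)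
      exact ((hle.and hev).mono fun z hz => hz.1.trans_lt hz.2).frequently
  -- (6) assemble: `‖E 1 x y‖ ≤ q 1 ≤ B 1 = q 0 + ∫₀¹ g ≤ Σ φ₀ G ψ₀`
  have hE1 : ‖E 1 x y‖ ≤ q 1 := by
    have hin : φ 1 x * ‖E 1 x y‖ * ψ 1 y ≤ q 1 := by
      simp only [hq_def]
      have h1 : φ 1 x * ‖E 1 x y‖ * ψ 1 y ≤ ∑ c, φ 1 x * ‖E 1 x c‖ * ψ 1 c :=
        single_le_sum (f := fun c => φ 1 x * ‖E 1 x c‖ * ψ 1 c)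
          (fun c _ => mul_nonneg (mul_nonneg (hφnn 1 h11 x) (norm_nonneg _)) (hψnn 1 h11 c)) (Finset.mem_univ y)
      refine h1.trans ?_
      exact single_le_sum (f := fun a => ∑ c, φ 1 a * ‖E 1 a c‖ * ψ 1 c)
        (fun a _ => sum_nonneg fun c _ => mul_nonneg (mul_nonneg (hφnn 1 h11 a) (norm_nonneg _)) (hψnn 1 h11 c)) (Finset.mem_univ x)
    have hφ1 : 1 ≤ φ 1 x := by
      have h : φ 1 x = 1 + 3 / 2 * m * v₁ 1 x := by simp [hφ_def]
      rw [h]; have := hv₁1 x; nlinarith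
    have hψ1 : 1 ≤ ψ 1 y := by
      have h : ψ 1 y = 1 + v₂ 1 y * (3 / 2 * m) := by simp [hψ_def]
      rw [h]; have := hv₂1 y; nlinarith
    have : ‖E 1 x y‖ ≤ φ 1 x * ‖E 1 x y‖ * ψ 1 y := by
      have h0 : 0 ≤ ‖E 1 x y‖ := norm_nonneg _
      calc ‖E 1 x y‖ = 1 * ‖E 1 x y‖ * 1 := by ring
        _ ≤ φ 1 x * ‖E 1 x y‖ * ψ 1 y := by gcongr
    exact this.trans hin
  -- the integral of the clamped density is the integral of `g`, bounded by the weights at time `0`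
  have hXn : ∀ a c, ContinuousOn (fun t => ‖X t a c‖) (uIcc (0 : ℝ) 1) := fun a c => by
    rw [Set.uIcc_of_le zero_le_one]; exact (hXc a c).norm
  have hXi : ∀ a c, IntervalIntegrable (fun t => ‖X t a c‖) MeasureTheory.volume 0 1 := fun a c => (hXn a c).intervalIntegrable
  have hint : (∫ τ in (0 : ℝ)..1, gt τ) ≤ ∑ a, ∑ c, φ 0 a * (∫ t in (0 : ℝ)..1, ‖X t a c‖) * ψ 0 c := by
    have heq : (∫ τ in (0 : ℝ)..1, gt τ) = ∫ τ in (0 : ℝ)..1, g τ :=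
      intervalIntegral.integral_congr fun τ hτ => hgt_eq τ (by rwa [Set.uIcc_of_le zero_le_one] at hτ)
    rw [heq]
    have hgi : IntervalIntegrable g MeasureTheory.volume 0 1 := (hgc.mono (Set.uIcc_of_le zero_le_one).subset).intervalIntegrable
    have hrow_c : ∀ a, ContinuousOn (fun τ => ∑ c, φ 0 a * ψ 0 c * ‖X τ a c‖) (uIcc (0 : ℝ) 1) := fun a =>
      continuousOn_finsetSum _ fun c _ => continuousOn_const.mul (hXn a c)
    have hrow_i : ∀ a, IntervalIntegrable (fun τ => ∑ c, φ 0 a * ψ 0 c * ‖X τ a c‖) MeasureTheory.volume 0 1 :=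
      fun a => (hrow_c a).intervalIntegrable
    have hh_c : ContinuousOn (fun τ => ∑ a, ∑ c, φ 0 a * ψ 0 c * ‖X τ a c‖) (uIcc (0 : ℝ) 1) :=
      continuousOn_finsetSum _ fun a _ => hrow_c a
    have hhi : IntervalIntegrable (fun τ => ∑ a, ∑ c, φ 0 a * ψ 0 c * ‖X τ a c‖) MeasureTheory.volume 0 1 := hh_c.intervalIntegrable
    have hmono : (∫ τ in (0 : ℝ)..1, g τ) ≤ ∫ τ in (0 : ℝ)..1, ∑ a, ∑ c, φ 0 a * ψ 0 c * ‖X τ a c‖ := by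
      refine intervalIntegral.integral_mono_on zero_le_one hgi hhi fun τ hτ => ?_
      simp only [hg_def]
      refine sum_le_sum fun a _ => sum_le_sum fun c _ => ?_
      calc φ τ a * ‖X τ a c‖ * ψ τ c ≤ φ 0 a * ‖X τ a c‖ * ψ 0 c :=
            mul_le_mul (mul_le_mul_of_nonneg_right (hφle τ hτ a) (norm_nonneg _)) (hψle τ hτ c) (hψnn τ hτ c)
              (mul_nonneg (hφnn 0 h01 a) (norm_nonneg _))
        _ = φ 0 a * ψ 0 c * ‖X τ a c‖ := by ring
    refine hmono.trans (le_of_eq ?_)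
    rw [intervalIntegral.integral_finsetSum fun a _ => hrow_i a]
    refine sum_congr rfl fun a _ => ?_
    rw [intervalIntegral.integral_finsetSum fun c _ => (hXi a c).const_mul (φ 0 a * ψ 0 c)]
    refine sum_congr rfl fun c _ => ?_
    rw [intervalIntegral.integral_const_mul]
    ring
  -- final chain
  have hfin : q 0 + (∫ τ in (0 : ℝ)..1, gt τ) ≤ ∑ a, ∑ c, φ 0 a * G a c * ψ 0 c := by
    have hq0 : q 0 = ∑ a, ∑ c, φ 0 a * ‖E 0 a c‖ * ψ 0 c := rfl
    rw [hq0]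
    calc ∑ a, ∑ c, φ 0 a * ‖E 0 a c‖ * ψ 0 c + ∫ τ in (0 : ℝ)..1, gt τ
        ≤ ∑ a, ∑ c, φ 0 a * ‖E 0 a c‖ * ψ 0 c + ∑ a, ∑ c, φ 0 a * (∫ t in (0 : ℝ)..1, ‖X t a c‖) * ψ 0 c :=
          add_le_add le_rfl hint
      _ = ∑ a, ∑ c, φ 0 a * (‖E 0 a c‖ + ∫ t in (0 : ℝ)..1, ‖X t a c‖) * ψ 0 c := by
          rw [← sum_add_distrib]; refine sum_congr rfl fun a _ => ?_
          rw [← sum_add_distrib]; refine sum_congr rfl fun c _ => ?_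
          ring
      _ ≤ ∑ a, ∑ c, φ 0 a * G a c * ψ 0 c := sum_le_sum fun a _ => sum_le_sum fun c _ =>
          mul_le_mul_of_nonneg_right (mul_le_mul_of_nonneg_left (hG a c) (hφnn 0 h01 a)) (hψnn 0 h01 c)
  have hexp := kltc_rd_fourTerm_expand G (fun a => 3 / 2 * m * v₁ 0 a) (fun c => v₂ 0 c * (3 / 2 * m)) x y
  have hB1 : B 1 = q 0 + ∫ τ in (0 : ℝ)..1, gt τ := rfl
  calc ‖E 1 x y‖ ≤ q 1 := hE1
    _ ≤ B 1 := hqB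
    _ ≤ ∑ a, ∑ c, φ 0 a * G a c * ψ 0 c := by rw [hB1]; exact hfin
    _ = ∑ a, ∑ c, ((if a = x then (1 : ℝ) else 0) + 3 / 2 * m * v₁ 0 a) * G a c *
          ((if c = y then (1 : ℝ) else 0) + v₂ 0 c * (3 / 2 * m)) := by simp only [hφ_def, hψ_def]
    _ = _ := by
        rw [hexp]
        have e2 : ∑ c, G x c * (v₂ 0 c * (3 / 2 * m)) = ∑ c, G x c * v₂ 0 c * (3 / 2 * m) :=
          sum_congr rfl fun c _ => by ring
        have e4 : ∑ a, ∑ c, 3 / 2 * m * v₁ 0 a * G a c * (v₂ 0 c * (3 / 2 * m)) =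
            ∑ a, ∑ c, 3 / 2 * m * v₁ 0 a * G a c * v₂ 0 c * (3 / 2 * m) :=
          sum_congr rfl fun a _ => sum_congr rfl fun c _ => by ring
        rw [e2, e4]

end ResolvedDuhamel

end Summit.HubbardSuperconductivity.HubbardSuperconductivity.Theorems.KLRegimeSplit

end
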